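import Literature.AnabelianGeometry.SemiGraphs.TemperedBranchPairProfinite
import Mathlib.Topology.Algebra.OpenSubgroup
import Mathlib.Topology.Algebra.Group.Compact
import Mathlib.Topology.Algebra.ConstMulAction
import Mathlib.Tactic.Group
import HarnessLib

/-!
# REFUTE-F1732 brick R6-limit, support for the estrangement route: conjugators mod a cofinal
# filtration converge in a compact group

Pure topological-group currency (Mathlib + the tree's `iInter_mul_coe_eq_of_isCompact`); abc-iut-L3-t5
gen 4, programme SUBDAG-SemiAnbd-Thm37iii-REFUTE brick R6-limit — the OPTIONAL estrangement route for
R6/R7 (the χ-character route of R6-level does not need it): it turns the level-wise containments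
«some conjugate of `c` lies in the incoming branch group and in a conjugate of the outgoing one, modulo
`U_j`» into a containment in the limit, where total estrangement ([SemiAnbd] Def. 2.4 (iv)) kills it.

For a compact Hausdorff group `G`, a decreasing sequence of open normal subgroups `U i` with
trivial intersection, closed subgroups `A`, `A'` and an element `a`:
* (`⋂ i, A * U i = A` is the tree's `iInter_mul_coe_eq_of_isCompact`, TemperedBranchPairProfinite);
* `exists_conj_mem_of_forall_level`: if at every level `i` some conjugate `q⁻¹ a q` lies in
  `A' * U i` and in `(s A s⁻¹) * U i`, then some conjugate `γ⁻¹ a γ` lies in `A'` and in `σ A σ⁻¹`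
  (Cantor's intersection theorem in `G × G`).  With an estrangement hypothesis
  `A' ⊓ σ A σ⁻¹ = ⊥` this forces `a = 1` (`eq_one_of_forall_level_of_estranged`).
[cite: MochizukiSemiAnbd2006, Thm 3.7(iii) pp.40-41]
-/

open scoped Pointwise

namespace Literature.AnabelianGeometry.SemiGraphs.RefuteF1732

variable {G : Type*} [Group G] [TopologicalSpace G] [IsTopologicalGroup G] [CompactSpace G]
  [T2Space G]

/-- Cantor-intersection form of the «limit lemma»: if at every level `i` of a decreasing open normal
filtration with trivial intersection some conjugate `q⁻¹ a q` lies in `A'·U i` and in `(s A s⁻¹)·U i`,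
then some conjugate `γ⁻¹ a γ` lies in `A'` and in `σ A σ⁻¹`. (Used with `q, s` read in the finite
quotients `G ⧸ U i`: the level-wise witnesses lift to `G`.)
[cite: MochizukiSemiAnbd2006, Thm 3.7(iii) pp.40-41] -/
theorem exists_conj_mem_of_forall_level (A A' : Subgroup G) (hA : IsClosed (A : Set G))
    (hA' : IsClosed (A' : Set G)) (U : ℕ → Subgroup G) [hUn : ∀ i, (U i).Normal]
    (hUo : ∀ i, IsOpen (U i : Set G)) (hUanti : ∀ i, U (i + 1) ≤ U i)
    (hUbot : ∀ x : G, (∀ i, x ∈ U i) → x = 1) (a : G)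
    (h : ∀ i, ∃ q s : G, q⁻¹ * a * q ∈ (A' : Set G) * (U i : Set G) ∧
      s⁻¹ * (q⁻¹ * a * q) * s ∈ (A : Set G) * (U i : Set G)) :
    ∃ γ σ : G, γ⁻¹ * a * γ ∈ A' ∧ σ⁻¹ * (γ⁻¹ * a * γ) * σ ∈ A := by
  -- closed sets in the compact space `G × G`
  have hmulcl : ∀ (B : Subgroup G), ∀ i, IsClosed ((B : Set G) * (U i : Set G)) := by
    intro B i
    have hsup : ((B ⊔ U i : Subgroup G) : Set G) = (B : Set G) * (U i : Set G) :=
      Subgroup.mul_normal B (U i)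
    rw [← hsup]
    apply Subgroup.isClosed_of_isOpen
    exact Subgroup.isOpen_mono (le_sup_right) (hUo i)
  let f₁ : G × G → G := fun p => p.1⁻¹ * a * p.1
  let f₂ : G × G → G := fun p => p.2⁻¹ * (p.1⁻¹ * a * p.1) * p.2
  have hf₁ : Continuous f₁ := by fun_prop
  have hf₂ : Continuous f₂ := by fun_prop
  let t : ℕ → Set (G × G) := fun i =>
    f₁ ⁻¹' ((A' : Set G) * (U i : Set G)) ∩ f₂ ⁻¹' ((A : Set G) * (U i : Set G))
  have htcl : ∀ i, IsClosed (t i) := fun i =>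
    ((hmulcl A' i).preimage hf₁).inter ((hmulcl A i).preimage hf₂)
  have htn : ∀ i, (t i).Nonempty := fun i => by
    obtain ⟨q, s, hq, hs⟩ := h i
    exact ⟨(q, s), hq, hs⟩
  have hmono : ∀ (B : Subgroup G) i, (B : Set G) * (U (i + 1) : Set G) ⊆ (B : Set G) * (U i : Set G) :=
    fun B i => Set.mul_subset_mul_left (fun y hy => hUanti i hy)
  have htd : ∀ i, t (i + 1) ⊆ t i := fun i p hp => ⟨hmono A' i hp.1, hmono A i hp.2⟩
  obtain ⟨⟨γ, σ⟩, hγσ⟩ := IsCompact.nonempty_iInter_of_sequence_nonempty_isCompact_isClosed t htd htn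
    ((htcl 0).isCompact) htcl
  rw [Set.mem_iInter] at hγσ
  have hanti : Antitone U := antitone_nat_of_succ_le hUanti
  have hdir : ∀ i j, ∃ k, U k ≤ U i ∧ U k ≤ U j :=
    fun i j => ⟨max i j, hanti (le_max_left i j), hanti (le_max_right i j)⟩
  refine ⟨γ, σ, ?_, ?_⟩
  · have hmem : f₁ (γ, σ) ∈ ⋂ i, ((A' : Set G) * (U i : Set G)) :=
      Set.mem_iInter.mpr fun i => (hγσ i).1
    rwa [iInter_mul_coe_eq_of_isCompact U hUo hdir hUbot hA'.isCompact] at hmem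
  · have hmem : f₂ (γ, σ) ∈ ⋂ i, ((A : Set G) * (U i : Set G)) :=
      Set.mem_iInter.mpr fun i => (hγσ i).2
    rwa [iInter_mul_coe_eq_of_isCompact U hUo hdir hUbot hA.isCompact] at hmem

/-- The estranged form: under the hypotheses of `exists_conj_mem_of_forall_level`, if moreover
`A' ⊓ σ A σ⁻¹ = ⊥` for every `σ` (estrangement of the two branch groups), then `a = 1`.
[cite: MochizukiSemiAnbd2006, Thm 3.7(iii) pp.40-41] -/
theorem eq_one_of_forall_level_of_estranged (A A' : Subgroup G) (hA : IsClosed (A : Set G))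
    (hA' : IsClosed (A' : Set G)) (U : ℕ → Subgroup G) [∀ i, (U i).Normal]
    (hUo : ∀ i, IsOpen (U i : Set G)) (hUanti : ∀ i, U (i + 1) ≤ U i)
    (hUbot : ∀ x : G, (∀ i, x ∈ U i) → x = 1)
    (hestr : ∀ σ : G, A' ⊓ A.map (MulAut.conj σ).toMonoidHom = ⊥) (a : G)
    (h : ∀ i, ∃ q s : G, q⁻¹ * a * q ∈ (A' : Set G) * (U i : Set G) ∧
      s⁻¹ * (q⁻¹ * a * q) * s ∈ (A : Set G) * (U i : Set G)) :
    a = 1 := by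
  obtain ⟨γ, σ, h₁, h₂⟩ := exists_conj_mem_of_forall_level A A' hA hA' U hUo hUanti hUbot a h
  have hconj : γ⁻¹ * a * γ ∈ A.map (MulAut.conj σ).toMonoidHom := by
    refine ⟨σ⁻¹ * (γ⁻¹ * a * γ) * σ, h₂, ?_⟩
    simp only [MulEquiv.toMonoidHom_eq_coe, MonoidHom.coe_coe, MulAut.conj_apply]
    group
  have hmem : γ⁻¹ * a * γ ∈ (A' ⊓ A.map (MulAut.conj σ).toMonoidHom) := ⟨h₁, hconj⟩
  rw [hestr σ, Subgroup.mem_bot] at hmem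
  calc a = γ * (γ⁻¹ * a * γ) * γ⁻¹ := by group
    _ = 1 := by rw [hmem]; group

end Literature.AnabelianGeometry.SemiGraphs.RefuteF1732
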